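import Summits.CriticalPhenomena.PercolationContinuityZ3.Theorems.SahiMasterFamilyPhiMinClosed

/-!
# Quotient-positive set functions form a multiplicative monoid containing the min-closed ones: `Φ_n ≥ 0` on all finite
# PRODUCTS of min-closed set functions, in particular on every CYLINDER SYSTEM `β_S = ∏_{x ∈ C(S)} q_x` — every order

Unit `prim-masterthm-p4` (gen 14; crux anchor stmt-CriticalPhenomena-4575, helper work; memo
`run/shared/lean/prim/prim-masterthm/prim-masterthm-p4/P4-GEN14-REPORT.md` §4).  Companion of `…PhiMinClosed` (Φ ≥ 0 at every min-closed
point) and `…PhiProduct` (the product theorem).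

Call `b : Finset (Fin N) → ℝ` QUOTIENT-POSITIVE if `Φ_L(Q ↦ b(⋃_{m∈Q} B_m)) ≥ 0` for every `L` and every family of pairwise disjoint blocks
`B : Fin L → Finset (Fin N)` (restrictions are the case of singleton blocks).  THIS FILE (no new definitions; the property is spelled out):
* `qp_of_minClosed` — every min-closed `[0,1]`-valued set function is quotient-positive (its quotients are min-closed; `…PhiMinClosed`);
* `qp_mul` — **quotient-positive functions are closed under pointwise products** (a quotient of `a·b` is the product of the quotients; the
  product theorem `PhiProduct.phiSet_mul_nonneg` one level up, restrictions of quotients being quotients along pulled-back blocks and quotients of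
  quotients being quotients along merged blocks); `qp_finset_prod` — hence under finite products; `phiSet_nonneg_of_qp` — and `Φ_N(b) ≥ 0`;
* **`phiSet_nonneg_of_prod_minClosed`** — `Φ_{n+1}(∏_{x∈s} β_x) ≥ 0` for any finite family of min-closed `[0,1]`-valued set functions, every order;
* **`phiSet_nonneg_of_cylinderSystem`** — for `q : X → [0,1]` and `C : Finset (Fin (n+1)) → Finset X` with `C(S ∪ T) ⊆ C(S) ∪ C(T)`:
  `Φ_{n+1}(S ↦ ∏_{x ∈ C(S)} q_x) ≥ 0` (each factor `S ↦ q_x^{[x ∈ C(S)]}` is the segment point of the union-closed family `{S : x ∉ C(S)}`).  Cylinder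
  systems are exactly the log-linear hull of the vertices `1_𝒰` of the feasible set of `F(n+1)` and exactly the β-normal forms of the "intersection-type
  G-systems" of the memo (§2); they contain Sahi's cylinder-event configurations [Sahi2008, Thm. 2] and all chains.  When `C(univ) = ∅` the point is
  feasible for `PhiNonneg (n+1)`, so **`F(n+1)` holds on the whole log-linear hull of the vertices, every order** (`phiNonneg_cylinderSystem`).
HONEST FRAMING: the feasible set `X_k` of `F(k)` is strictly larger than this hull already at `k = 4` (memo §3: exact rational witnesses), so `PhiNonneg k`
(k ≥ 8), Sahi's `C_k`, Kahn's Conjecture 5 and the master theorem remain OPEN.  Axioms standard. [this work]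
-/

noncomputable section

open scoped Classical

namespace Summit.CriticalPhenomena.PercolationContinuityZ3.Theorems

namespace PhiCylinder

open Finset Function
open Literature.Combinatorics.Sahi2008
open PrincipalCapBeta (phiSet)

variable {N : ℕ}

/-! ### Block bookkeeping -/

/-- `⋃` over a mapped index set. [folklore] -/
theorem biUnion_map_eq {L L' : ℕ} (e : Fin L' ↪ Fin L) (B : Fin L → Finset (Fin N)) (S : Finset (Fin L')) :
    (S.map e).biUnion B = S.biUnion (fun i => B (e i)) := by
  ext x
  simp only [mem_biUnion, mem_map]
  constructor
  · rintro ⟨a, ⟨i, hi, rfl⟩, hx⟩; exact ⟨i, hi, hx⟩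
  · rintro ⟨i, hi, hx⟩; exact ⟨e i, ⟨i, hi, rfl⟩, hx⟩

/-- Pulled-back blocks stay pairwise disjoint. [folklore] -/
theorem disjoint_comp {L L' : ℕ} (e : Fin L' ↪ Fin L) {B : Fin L → Finset (Fin N)} (hB : ∀ i j, i ≠ j → Disjoint (B i) (B j))
    (i j : Fin L') (hij : i ≠ j) : Disjoint (B (e i)) (B (e j)) :=
  hB _ _ fun h => hij (e.injective h)

/-- Merged blocks stay pairwise disjoint. [folklore] -/
theorem disjoint_merge {L L' : ℕ} {B' : Fin L' → Finset (Fin L)} (hB' : ∀ i j, i ≠ j → Disjoint (B' i) (B' j))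
    {B : Fin L → Finset (Fin N)} (hB : ∀ i j, i ≠ j → Disjoint (B i) (B j)) (i j : Fin L') (hij : i ≠ j) :
    Disjoint ((B' i).biUnion B) ((B' j).biUnion B) := by
  rw [Finset.disjoint_biUnion_left]
  intro x hx
  rw [Finset.disjoint_biUnion_right]
  intro y hy
  exact hB x y fun hxy => Finset.disjoint_left.1 (hB' i j hij) hx (hxy ▸ hy)

/-- Singleton blocks are pairwise disjoint. [folklore] -/
theorem disjoint_singletons (i j : Fin N) (hij : i ≠ j) : Disjoint ({i} : Finset (Fin N)) {j} :=
  Finset.disjoint_singleton.2 hij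

/-- `⋃_{i∈S} {i} = S`. [folklore] -/
theorem biUnion_singleton_eq (S : Finset (Fin N)) : S.biUnion (fun i => ({i} : Finset (Fin N))) = S := by
  ext x; simp

/-! ### Quotient positivity: consequences and closure under products -/

/-- Quotient positivity gives `Φ_N ≥ 0` (singleton blocks). [this work] -/
theorem phiSet_nonneg_of_qp (b : Finset (Fin N) → ℝ)
    (hb : ∀ (L : ℕ) (B : Fin L → Finset (Fin N)), (∀ i j, i ≠ j → Disjoint (B i) (B j)) →
      0 ≤ phiSet L (fun Q => b (Q.biUnion B))) :
    0 ≤ phiSet N b := by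
  have h := hb N (fun i => {i}) disjoint_singletons
  have hfun : (fun Q : Finset (Fin N) => b (Q.biUnion fun i => ({i} : Finset (Fin N)))) = b := funext fun Q => by rw [biUnion_singleton_eq]
  rwa [hfun] at h

/-- Quotient positivity gives positivity of every restriction. [this work] -/
theorem phiSet_map_nonneg_of_qp (b : Finset (Fin N) → ℝ)
    (hb : ∀ (L : ℕ) (B : Fin L → Finset (Fin N)), (∀ i j, i ≠ j → Disjoint (B i) (B j)) →
      0 ≤ phiSet L (fun Q => b (Q.biUnion B)))
    (L : ℕ) (e : Fin L ↪ Fin N) : 0 ≤ phiSet L (fun S => b (S.map e)) := by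
  have h := hb L (fun i => {e i}) fun i j hij => disjoint_singletons _ _ fun h => hij (e.injective h)
  have hfun : (fun Q : Finset (Fin L) => b (Q.biUnion fun i => ({e i} : Finset (Fin N)))) = fun S => b (S.map e) := by
    funext Q
    congr 1
    ext x
    simp only [mem_biUnion, mem_singleton, mem_map]
    constructor
    · rintro ⟨i, hi, rfl⟩; exact ⟨i, hi, rfl⟩
    · rintro ⟨i, hi, rfl⟩; exact ⟨i, hi, rfl⟩
  rwa [hfun] at h

/-- **Quotient-positive functions are closed under pointwise products.** [this work] -/
theorem qp_mul (a b : Finset (Fin N) → ℝ)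
    (ha : ∀ (L : ℕ) (B : Fin L → Finset (Fin N)), (∀ i j, i ≠ j → Disjoint (B i) (B j)) →
      0 ≤ phiSet L (fun Q => a (Q.biUnion B)))
    (hb : ∀ (L : ℕ) (B : Fin L → Finset (Fin N)), (∀ i j, i ≠ j → Disjoint (B i) (B j)) →
      0 ≤ phiSet L (fun Q => b (Q.biUnion B))) :
    ∀ (L : ℕ) (B : Fin L → Finset (Fin N)), (∀ i j, i ≠ j → Disjoint (B i) (B j)) →
      0 ≤ phiSet L (fun Q => a (Q.biUnion B) * b (Q.biUnion B)) := by
  intro L B hB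
  cases L with
  | zero => exact PhiProduct.phiSet_zero_nonneg _
  | succ l =>
    refine PhiProduct.phiSet_mul_nonneg (fun Q => a (Q.biUnion B)) (fun Q => b (Q.biUnion B)) (fun L' e => ?_) (fun L' B' hB' => ?_)
    · -- a restriction of the quotient of `a` is the quotient of `a` along the pulled-back blocks
      have h := ha L' (fun i => B (e i)) (disjoint_comp e hB)
      have hfun : (fun S : Finset (Fin L') => a ((S.map e).biUnion B)) = fun S => a (S.biUnion fun i => B (e i)) :=
        funext fun S => by rw [biUnion_map_eq]
      show 0 ≤ phiSet L' (fun S : Finset (Fin L') => a ((S.map e).biUnion B))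
      rwa [hfun]
    · -- a quotient of the quotient of `b` is the quotient of `b` along the merged blocks
      have h := hb L' (fun m => (B' m).biUnion B) (disjoint_merge hB' hB)
      have hfun : (fun Q : Finset (Fin L') => b ((Q.biUnion B').biUnion B)) = fun Q => b (Q.biUnion fun m => (B' m).biUnion B) :=
        funext fun Q => by rw [Finset.biUnion_biUnion]
      show 0 ≤ phiSet L' (fun Q : Finset (Fin L') => b ((Q.biUnion B').biUnion B))
      rwa [hfun]

/-- **Min-closed `[0,1]`-valued set functions are quotient-positive** (their quotients are min-closed). [this work] -/
theorem qp_of_minClosed (β : Finset (Fin N) → ℝ) (h0 : ∀ B, 0 ≤ β B) (h1 : ∀ B, β B ≤ 1)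
    (hmin : ∀ S T, min (β S) (β T) ≤ β (S ∪ T)) :
    ∀ (L : ℕ) (B : Fin L → Finset (Fin N)), (∀ i j, i ≠ j → Disjoint (B i) (B j)) →
      0 ≤ phiSet L (fun Q => β (Q.biUnion B)) := by
  intro L B _
  cases L with
  | zero => exact PhiProduct.phiSet_zero_nonneg _
  | succ l =>
    exact PhiMinClosed.phiSet_nonneg_of_minClosed _ (fun Q => h0 _) (fun Q => h1 _) fun S T => by
      show min (β (S.biUnion B)) (β (T.biUnion B)) ≤ β ((S ∪ T).biUnion B)
      rw [Finset.union_biUnion]; exact hmin _ _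

/-- The all-ones function is quotient-positive. [this work] -/
theorem qp_one : ∀ (L : ℕ) (B : Fin L → Finset (Fin N)), (∀ i j, i ≠ j → Disjoint (B i) (B j)) →
    0 ≤ phiSet L (fun Q => (fun _ : Finset (Fin N) => (1 : ℝ)) (Q.biUnion B)) :=
  qp_of_minClosed _ (fun _ => zero_le_one) (fun _ => le_rfl) (fun _ _ => by rw [min_self])

/-- **Finite products of quotient-positive functions are quotient-positive.** [this work] -/
theorem qp_finset_prod {X : Type*} (f : X → Finset (Fin N) → ℝ) (s : Finset X)
    (hf : ∀ x ∈ s, ∀ (L : ℕ) (B : Fin L → Finset (Fin N)), (∀ i j, i ≠ j → Disjoint (B i) (B j)) →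
      0 ≤ phiSet L (fun Q => f x (Q.biUnion B))) :
    ∀ (L : ℕ) (B : Fin L → Finset (Fin N)), (∀ i j, i ≠ j → Disjoint (B i) (B j)) →
      0 ≤ phiSet L (fun Q => (∏ x ∈ s, f x (Q.biUnion B))) := by
  induction s using Finset.induction_on with
  | empty =>
    intro L B hB
    have h := qp_one (N := N) L B hB
    simpa only [prod_empty] using h
  | insert a s ha ih =>
    intro L B hB
    have h := qp_mul (f a) (fun S => ∏ x ∈ s, f x S) (hf a (mem_insert_self a s))
      (ih fun x hx => hf x (mem_insert_of_mem hx)) L B hB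
    simpa only [prod_insert ha] using h

/-! ### Products of min-closed functions; cylinder systems -/

/-- **`Φ ≥ 0` on finite products of min-closed set functions, every order.** [this work] -/
theorem phiSet_nonneg_of_prod_minClosed {X : Type*} (s : Finset X) (β : X → Finset (Fin N) → ℝ)
    (h0 : ∀ x ∈ s, ∀ B, 0 ≤ β x B) (h1 : ∀ x ∈ s, ∀ B, β x B ≤ 1) (hmin : ∀ x ∈ s, ∀ S T, min (β x S) (β x T) ≤ β x (S ∪ T)) :
    0 ≤ phiSet N (fun S => ∏ x ∈ s, β x S) :=
  phiSet_nonneg_of_qp _ (qp_finset_prod β s fun x hx => qp_of_minClosed (β x) (h0 x hx) (h1 x hx) (hmin x hx))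

/-- The factor `S ↦ q^{[x ∈ C(S)]}` of a cylinder system is min-closed when `C` is union-subadditive. [this work] -/
theorem minClosed_cylinderFactor {X : Type*} (C : Finset (Fin N) → Finset X) (hC : ∀ S T, C (S ∪ T) ⊆ C S ∪ C T)
    {q : ℝ} (hq1 : q ≤ 1) (x : X) (S T : Finset (Fin N)) :
    min (if x ∈ C S then q else 1) (if x ∈ C T then q else 1) ≤ (if x ∈ C (S ∪ T) then q else 1) := by
  by_cases h : x ∈ C (S ∪ T)
  · rw [if_pos h]
    rcases mem_union.1 (hC S T h) with hS | hT
    · rw [if_pos hS]; exact min_le_left _ _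
    · rw [if_pos hT]; exact min_le_right _ _
  · rw [if_neg h]
    exact (min_le_left _ _).trans (by split_ifs <;> [exact hq1; exact le_rfl])

/-- **`Φ_N ≥ 0` on every cylinder system**: `β_S = ∏_{x∈C(S)} q_x` with `q ∈ [0,1]^X` and `C(S ∪ T) ⊆ C(S) ∪ C(T)`. [this work] -/
theorem phiSet_nonneg_of_cylinderSystem {X : Type*} [Fintype X] (C : Finset (Fin N) → Finset X)
    (hC : ∀ S T, C (S ∪ T) ⊆ C S ∪ C T) (q : X → ℝ) (hq0 : ∀ x, 0 ≤ q x) (hq1 : ∀ x, q x ≤ 1) :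
    0 ≤ phiSet N (fun S => ∏ x ∈ C S, q x) := by
  have hfun : (fun S : Finset (Fin N) => ∏ x ∈ C S, q x) = fun S => ∏ x ∈ (univ : Finset X), (if x ∈ C S then q x else 1) := by
    funext S
    rw [prod_ite_mem, univ_inter]
  rw [hfun]
  refine phiSet_nonneg_of_prod_minClosed univ (fun x S => if x ∈ C S then q x else 1) (fun x _ B => ?_) (fun x _ B => ?_)
    (fun x _ S T => minClosed_cylinderFactor C hC (hq1 x) x S T)
  · show 0 ≤ (if x ∈ C B then q x else 1); split_ifs <;> [exact hq0 x; exact zero_le_one]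
  · show (if x ∈ C B then q x else 1) ≤ 1; split_ifs <;> [exact hq1 x; exact le_rfl]

/-- **`F(n+1)` on the log-linear hull of the vertices**: a cylinder system with `C(univ) = ∅` is a feasible point of `PhiNonneg (n+1)` (values in
`[0,1]`, top value `1`, supermultiplicative) and `Φ_{n+1} ≥ 0` there, every order. [this work] -/
theorem phiNonneg_cylinderSystem {n : ℕ} {X : Type*} [Fintype X] (C : Finset (Fin (n + 1)) → Finset X)
    (hC : ∀ S T, C (S ∪ T) ⊆ C S ∪ C T) (htop : C univ = ∅) (q : X → ℝ) (hq0 : ∀ x, 0 ≤ q x) (hq1 : ∀ x, q x ≤ 1) :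
    (fun S : Finset (Fin (n + 1)) => ∏ x ∈ C S, q x) univ = 1 ∧
      (∀ S T, (fun S : Finset (Fin (n + 1)) => ∏ x ∈ C S, q x) S * (fun S : Finset (Fin (n + 1)) => ∏ x ∈ C S, q x) T ≤
        (fun S : Finset (Fin (n + 1)) => ∏ x ∈ C S, q x) (S ∪ T)) ∧
      0 ≤ phiSet (n + 1) (fun S => ∏ x ∈ C S, q x) := by
  refine ⟨by show ∏ x ∈ C univ, q x = 1; rw [htop, prod_empty], fun S T => ?_, phiSet_nonneg_of_cylinderSystem C hC q hq0 hq1⟩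
  show (∏ x ∈ C S, q x) * (∏ x ∈ C T, q x) ≤ ∏ x ∈ C (S ∪ T), q x
  have hle1 : ∀ (A : Finset X), ∏ x ∈ A, q x ≤ 1 := fun A => prod_le_one (fun x _ => hq0 x) (fun x _ => hq1 x)
  have hge0 : ∀ (A : Finset X), 0 ≤ ∏ x ∈ A, q x := fun A => prod_nonneg fun x _ => hq0 x
  -- ∏_{C S ∪ C T} q ≤ ∏_{C (S∪T)} q  since C (S ∪ T) ⊆ C S ∪ C T and q ≤ 1; and ∏_{C S}∏_{C T} ≤ ∏_{C S ∪ C T}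
  calc (∏ x ∈ C S, q x) * (∏ x ∈ C T, q x)
      = (∏ x ∈ C S ∪ C T, q x) * (∏ x ∈ C S ∩ C T, q x) := (prod_union_inter).symm
    _ ≤ (∏ x ∈ C S ∪ C T, q x) * 1 := mul_le_mul_of_nonneg_left (hle1 _) (hge0 _)
    _ = ∏ x ∈ C S ∪ C T, q x := mul_one _
    _ = (∏ x ∈ C (S ∪ T), q x) * ∏ x ∈ (C S ∪ C T) \ C (S ∪ T), q x := by
        rw [← prod_sdiff (hC S T), mul_comm]
    _ ≤ (∏ x ∈ C (S ∪ T), q x) * 1 := mul_le_mul_of_nonneg_left (hle1 _) (hge0 _)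
    _ = ∏ x ∈ C (S ∪ T), q x := mul_one _

end PhiCylinder

end Summit.CriticalPhenomena.PercolationContinuityZ3.Theorems
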